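import Mathlib
import Summits.NavierStokesRegularity.NavierStokesRegularity.Theorems.WakeRatchetTailRatchetRelayDrainFreeSignChange
import Summits.NavierStokesRegularity.NavierStokesRegularity.Theorems.WakeRatchetTailRatchetRelayDrainFreeSlowDecay
import Summits.NavierStokesRegularity.NavierStokesRegularity.Theorems.WakeRatchetTailRatchetRelayDrainFreeUnique
import HarnessLib

/-!
# `WakeRatchet.TailRatchet` (stmt-NavierStokesRegularity-21808): DRAIN-FREE RIGIDITY — the drain-free scalar
# front equation `b' = (4/s²) b(t/s)²` carries an admissible front only at the relay ratio `s = 2`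
# (census item G0, analytic)

Support file for the crux `TailRatchet` (route `WakeRatchet`; MODEL lattice ODEs of Tao 2016 §1.2, §4 — nothing
in this file is a statement about the Navier–Stokes equations, and no item is closed here).

Context (census of stmt-21808, continuation programme "R-glob").  The lacunary branch of exact scalar dyadic DSS
fronts of `b' = (4/s²)b(t/s)² − 4sδ·b(t)b(st)` (`δ = Λ⁻²`) emanates from the relay point `(s, δ) = (2, 0)`
(`…RelayFront`, `…LacunaryFrontAll`).  Its continuation to `δ → 1⁻` (`Λ → 1⁺`, the end that would refute
`TailRatchet`) must rule out a return of the branch to the drain-free axis `δ = 0` at some `s ≠ 2`.  This file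
proves that the drain-free axis carries NO admissible front except at `s = 2`:

* `pos_of_integrable` — an integrable, not identically zero solution, continuous on `(−∞,0]`, is POSITIVE on
  `(−∞,0]` (`b' ≥ 0`; integrability forces `b → 0` at `−∞`, so `b ≥ 0`; a zero at `t₀ < 0` would make `b`
  vanish on `(−∞,t₀]`, hence `b'` and then `b(·/s)` vanish there, and iterating `t₀ ↦ t₀/s → 0⁻` kills `b`);
* `drainfree_rigidity` — **if `s > 1` and `b' = (4/s²)b(t/s)²` on `t < 0` has a solution continuous on
  `(−∞,0]`, integrable on `(−∞,0)` and not identically zero, then `s = 2`** (`s > 2`: `…DrainFreeSignChange.barrier`;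
  `s < 2`: `…DrainFreeSlowDecay.not_integrableOn`);
* `drainfree_classification` — and then `b(t) = b(0)·e^{b(0)t}` (IVP uniqueness `…DrainFreeUnique` against the
  scaled relay profile);
* `drainfree_rigidity_bigLam` — the same in the `Λ`-normalisation `a' = (Λ/s²)a(t/s)²` of `DyadicScalarFronts`.

So the only admissible drain-free fronts are the relay profiles `c·e^{ct}`, `c > 0`, at `s = 2` — the analytic
form of the numerical record of `…RelayDrainFreeUnique` (G0 of the census).  What this does NOT give: anything at
`δ > 0`; the compactness / non-degeneracy steps G1–G5 of the continuation stay open, and so do the construction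
item `DyadicScalarFronts` (along `ε₀ → 0`) and the crux.

HONEST FRAMING: elementary real analysis of a MODEL functional ODE; nothing here concerns Navier–Stokes.
-/

noncomputable section

set_option linter.dupNamespace false

namespace Summit.NavierStokesRegularity.NavierStokesRegularity.Theorems

namespace WakeRatchetRelayDrainFreeRigidity

open Set Filter Topology MeasureTheory
open WakeRatchetRelayDrainFreeSignChange WakeRatchetRelayDrainFreeSlow WakeRatchetRelayDrainFreeSlowDecay
  WakeRatchetRelayDrainFreeUnique

variable {s : ℝ} {b : ℝ → ℝ}

/-! ## Positivity of admissible solutions -/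

/-- An integrable solution, non-decreasing on `(−∞,0]`, is non-negative there. [folklore] -/
theorem nonneg_of_integrable (hmono : MonotoneOn b (Iic 0)) (hint : IntegrableOn b (Iio 0)) :
    ∀ t : ℝ, t ≤ 0 → 0 ≤ b t := by
  intro t ht
  by_contra hneg
  push Not at hneg
  set ε : ℝ := -b t with hε
  have hε0 : 0 < ε := by rw [hε]; linarith
  have hfin := Integrable.measure_norm_ge_lt_top hint hε0
  have hsub : Iio t ⊆ {x | ε ≤ ‖b x‖} := by
    intro x hx
    have h1 : b x ≤ b t := hmono (le_of_lt (lt_of_lt_of_le hx ht)) ht hx.le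
    show ε ≤ ‖b x‖
    rw [Real.norm_eq_abs, abs_of_neg (by linarith)]
    linarith
  have hIio : (volume.restrict (Iio (0 : ℝ))) (Iio t) = ⊤ := by
    rw [Measure.restrict_apply measurableSet_Iio, inter_eq_left.2 (Iio_subset_Iio ht), Real.volume_Iio]
  have := measure_mono (μ := volume.restrict (Iio (0 : ℝ))) hsub
  rw [hIio, top_le_iff] at this
  exact hfin.ne this

/-- If a solution vanishes on `(−∞, c)` (`c < 0`), it vanishes on `(−∞, c/s)`: the equation at `t < c` reads
`0 = b'(t) = (4/s²) b(t/s)²`. [folklore] -/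
theorem vanish_step (hs : 1 < s) (hd : ∀ t : ℝ, t < 0 → HasDerivAt b (4 / s ^ 2 * b (t / s) ^ 2) t)
    {c : ℝ} (hc : c < 0) (hz : ∀ t : ℝ, t < c → b t = 0) : ∀ t : ℝ, t < c / s → b t = 0 := by
  have hs0 : 0 < s := by linarith
  intro t ht
  have hst : s * t < c := by rwa [lt_div_iff₀ hs0, mul_comm] at ht
  have hst0 : s * t < 0 := hst.trans hc
  -- `b` is locally zero at `s t`, so its derivative there is `0`
  have hzero : HasDerivAt b 0 (s * t) := by
    have hev : ∀ᶠ x in 𝓝 (s * t), b x = (fun _ => (0 : ℝ)) x :=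
      Filter.eventually_of_mem (Iio_mem_nhds hst) fun x hx => hz x hx
    exact (hasDerivAt_const (s * t) (0 : ℝ)).congr_of_eventuallyEq hev
  have huniq := (hd (s * t) hst0).unique hzero
  have h1 : b (s * t / s) ^ 2 = 0 := by
    have h4 : (4 : ℝ) / s ^ 2 ≠ 0 := by positivity
    exact (mul_eq_zero.1 huniq).resolve_left h4
  rw [mul_div_cancel_left₀ t hs0.ne'] at h1
  exact pow_eq_zero_iff (n := 2) (by norm_num) |>.1 h1

/-- **Positivity of admissible drain-free solutions.**  For `s > 1`, a solution of `b' = (4/s²)b(t/s)²`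
(`t < 0`), continuous on `(−∞,0]`, integrable on `(−∞,0)` and not identically zero on `(−∞,0]`, is
positive on `(−∞,0]`.
[cite: Tao2016AveragedNS, §1.2 (dyadic model); cell vocabulary (drain-free scalar front equation of `DyadicScalarFronts`, census item G0 of stmt-21808)] -/
theorem pos_of_integrable (hs : 1 < s) (hc : ContinuousOn b (Iic 0))
    (hd : ∀ t : ℝ, t < 0 → HasDerivAt b (4 / s ^ 2 * b (t / s) ^ 2) t)
    (hint : IntegrableOn b (Iio 0)) (hne : ∃ t : ℝ, t ≤ 0 ∧ b t ≠ 0) :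
    ∀ t : ℝ, t ≤ 0 → 0 < b t := by
  have hs0 : 0 < s := by linarith
  have hmono := WakeRatchetRelayDrainFreeSlow.monotoneOn hc hd
  have hnonneg := nonneg_of_integrable hmono hint
  -- it suffices to exclude a zero at some `t₀ ≤ 0`
  by_contra hcon
  push Not at hcon
  obtain ⟨t₀, ht₀, hb₀⟩ := hcon
  have hz₀ : b t₀ = 0 := le_antisymm hb₀ (hnonneg t₀ ht₀)
  -- `b` vanishes on `(−∞, t₀]`
  have hzle : ∀ t : ℝ, t ≤ t₀ → b t = 0 := fun t ht =>
    le_antisymm (hz₀ ▸ hmono (ht.trans ht₀) ht₀ ht) (hnonneg t (ht.trans ht₀))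
  -- hence `b 0 = 0`: either `t₀ = 0`, or iterate `vanish_step` and use continuity at `0`
  have hb0 : b 0 = 0 := by
    rcases eq_or_lt_of_le ht₀ with h | h
    · subst h; exact hz₀
    · -- `b = 0` on `(−∞, t₀ / s^k)` for every `k`
      have hiter : ∀ k : ℕ, ∀ t : ℝ, t < t₀ / s ^ k → b t = 0 := by
        intro k
        induction k with
        | zero => intro t ht; rw [pow_zero, div_one] at ht; exact hzle t ht.le
        | succ k ih =>
          have hck : t₀ / s ^ k < 0 := div_neg_of_neg_of_pos h (pow_pos hs0 k)
          have := vanish_step hs hd hck ih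
          intro t ht
          refine this t ?_
          rw [pow_succ, ← div_div] at ht
          exact ht
      -- so `b = 0` on `(−∞, 0)`
      have hzneg : ∀ t : ℝ, t < 0 → b t = 0 := by
        intro t ht
        obtain ⟨k, hk⟩ := pow_unbounded_of_one_lt (t₀ / t) hs
        refine hiter k t ?_
        rw [lt_div_iff₀ (pow_pos hs0 k)]
        have ht' : 0 < -t := neg_pos.2 ht
        have : t₀ / t * (-t) = -t₀ := by rw [mul_neg, div_mul_cancel₀ _ ht.ne]
        nlinarith
      -- continuity at `0` from the left
      have hcw : ContinuousWithinAt b (Iic 0) 0 := hc 0 self_mem_Iic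
      have hcw' : ContinuousWithinAt b (Iio 0) 0 := hcw.mono Iio_subset_Iic_self
      have hlim : Tendsto b (𝓝[Iio 0] 0) (𝓝 0) := by
        refine (tendsto_congr' ?_).1 tendsto_const_nhds
        exact eventually_nhdsWithin_of_forall fun x hx => (hzneg x hx).symm
      exact tendsto_nhds_unique hcw'.tendsto hlim
  -- contradiction with non-triviality: `b ≤ b 0 = 0` and `b ≥ 0` on `(−∞,0]`
  obtain ⟨t₁, ht₁, hb₁⟩ := hne
  exact hb₁ (le_antisymm (hb0 ▸ hmono ht₁ (le_refl (0 : ℝ)) ht₁) (hnonneg t₁ ht₁))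

/-! ## Rigidity and classification -/

/-- **DRAIN-FREE RIGIDITY (census G0 of stmt-21808).**  Let `s > 1` and let `b` solve the drain-free scalar front
equation `b'(t) = (4/s²) b(t/s)²` on `t < 0`, be continuous on `(−∞,0]`, integrable on `(−∞,0)` and not
identically zero on `(−∞,0]`.  Then `s = 2`.
[cite: Tao2016AveragedNS, §1.2 (dyadic model); cell vocabulary (drain-free scalar front equation of `DyadicScalarFronts`, census item G0 of stmt-21808)] -/
theorem drainfree_rigidity (hs : 1 < s) (hc : ContinuousOn b (Iic 0))
    (hd : ∀ t : ℝ, t < 0 → HasDerivAt b (4 / s ^ 2 * b (t / s) ^ 2) t)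
    (hint : IntegrableOn b (Iio 0)) (hne : ∃ t : ℝ, t ≤ 0 ∧ b t ≠ 0) : s = 2 := by
  have hpos := pos_of_integrable hs hc hd hint hne
  rcases lt_trichotomy s 2 with h | h | h
  · exact absurd hint (not_integrableOn hs h hc hd hpos)
  · exact h
  · exfalso
    have hb0 : 0 < b 0 := hpos 0 le_rfl
    have hs2 : 0 < s - 2 := by linarith
    set T : ℝ := -(s ^ 3 / (4 * (s - 2) * b 0)) with hT
    have hT0 : T ≤ 0 := by rw [hT]; exact neg_nonpos.2 (by positivity)
    have hbar := barrier h hc hd hT0 fun t ht => hpos t ht.2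
    have : 4 * (s - 2) * b 0 * (-T) = s ^ 3 := by rw [hT, neg_neg]; field_simp
    linarith

/-- **Classification of admissible drain-free fronts.**  Under the hypotheses of `drainfree_rigidity`, `s = 2` and
`b(t) = b(0)·e^{b(0)t}` on `(−∞,0]` — a scaled relay profile (`b(0) > 0`).
[cite: Tao2016AveragedNS, §1.2 (dyadic model); cell vocabulary (drain-free scalar front equation of `DyadicScalarFronts`, census item G0 of stmt-21808)] -/
theorem drainfree_classification (hs : 1 < s) (hc : ContinuousOn b (Iic 0))
    (hd : ∀ t : ℝ, t < 0 → HasDerivAt b (4 / s ^ 2 * b (t / s) ^ 2) t)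
    (hint : IntegrableOn b (Iio 0)) (hne : ∃ t : ℝ, t ≤ 0 ∧ b t ≠ 0) :
    s = 2 ∧ 0 < b 0 ∧ ∀ t : ℝ, t ≤ 0 → b t = b 0 * Real.exp (b 0 * t) := by
  have hs2 := drainfree_rigidity hs hc hd hint hne
  have hpos := pos_of_integrable hs hc hd hint hne
  have hb0 : 0 < b 0 := hpos 0 le_rfl
  refine ⟨hs2, hb0, ?_⟩
  subst hs2
  have hmono := WakeRatchetRelayDrainFreeSlow.monotoneOn hc hd
  -- the comparison solution `b₂(t) = b(0) e^{b(0) t}`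
  set b₂ : ℝ → ℝ := fun t => b 0 * Real.exp (b 0 * t) with hb₂
  have hd₂ : ∀ t : ℝ, t < 0 → HasDerivAt b₂ (4 / (2 : ℝ) ^ 2 * b₂ (t / 2) ^ 2) t := by
    intro t _
    have h1 : HasDerivAt (fun x => b 0 * x) (b 0) t := by
      simpa using (hasDerivAt_id t).const_mul (b 0)
    have h2 : HasDerivAt (fun x => Real.exp (b 0 * x)) (Real.exp (b 0 * t) * b 0) t := h1.exp
    have h3 := h2.const_mul (b 0)
    refine h3.congr_deriv ?_
    show b 0 * (Real.exp (b 0 * t) * b 0) = 4 / 2 ^ 2 * (b 0 * Real.exp (b 0 * (t / 2))) ^ 2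
    rw [mul_pow, sq (Real.exp _), ← Real.exp_add]
    ring_nf
  have hc₂ : ContinuousOn b₂ (Iic 0) :=
    (continuous_const.mul (Real.continuous_exp.comp (continuous_const.mul continuous_id))).continuousOn
  have hB₁ : ∀ t : ℝ, t ≤ 0 → |b t| ≤ b 0 := by
    intro t ht
    rw [abs_of_pos (hpos t ht)]
    exact hmono ht (le_refl (0 : ℝ)) ht
  have hB₂ : ∀ t : ℝ, t ≤ 0 → |b₂ t| ≤ b 0 := by
    intro t ht
    have h1 : 0 < b₂ t := by rw [hb₂]; positivity
    rw [abs_of_pos h1, hb₂]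
    have h2 : Real.exp (b 0 * t) ≤ 1 := Real.exp_le_one_iff.2 (by nlinarith)
    calc b 0 * Real.exp (b 0 * t) ≤ b 0 * 1 := mul_le_mul_of_nonneg_left h2 hb0.le
      _ = b 0 := mul_one _
  have h0 : b 0 = b₂ 0 := by simp [hb₂]
  intro t ht
  exact drainfree_ivp_unique hs hc hc₂ hd hd₂ hB₁ hB₂ h0 t ht

/-- **Drain-free rigidity in the `Λ`-normalisation of `DyadicScalarFronts`.**  If `Λ > 0`, `s > 1` and `a` solves the
drain-free part `a'(t) = (Λ/s²)·a(t/s)²` of the scalar front equation of `WakeRatchetDyadicFront.DyadicScalarFronts` on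
`t < 0`, is continuous on `(−∞,0]`, integrable on `(−∞,0)` and not identically zero there, then `s = 2`
(apply `drainfree_rigidity` to `b = (Λ/4)·a`).
[cite: Tao2016AveragedNS, §1.2 (dyadic model); cell vocabulary (scalar front equation of `DyadicScalarFronts`, census item G0 of stmt-21808)] -/
theorem drainfree_rigidity_bigLam {Λ : ℝ} {a : ℝ → ℝ} (hΛ : 0 < Λ) (hs : 1 < s)
    (hc : ContinuousOn a (Iic 0))
    (hd : ∀ t : ℝ, t < 0 → HasDerivAt a (Λ / s ^ 2 * a (t / s) ^ 2) t)
    (hint : IntegrableOn a (Iio 0)) (hne : ∃ t : ℝ, t ≤ 0 ∧ a t ≠ 0) : s = 2 := by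
  set b : ℝ → ℝ := fun t => Λ / 4 * a t with hb
  have hcb : ContinuousOn b (Iic 0) := continuousOn_const.mul hc
  have hdb : ∀ t : ℝ, t < 0 → HasDerivAt b (4 / s ^ 2 * b (t / s) ^ 2) t := by
    intro t ht
    refine ((hd t ht).const_mul (Λ / 4)).congr_deriv ?_
    show Λ / 4 * (Λ / s ^ 2 * a (t / s) ^ 2) = 4 / s ^ 2 * (Λ / 4 * a (t / s)) ^ 2
    ring
  have hintb : IntegrableOn b (Iio 0) := hint.const_mul (Λ / 4)
  obtain ⟨t₀, ht₀, hne₀⟩ := hne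
  have hneb : ∃ t : ℝ, t ≤ 0 ∧ b t ≠ 0 := ⟨t₀, ht₀, mul_ne_zero (by positivity) hne₀⟩
  exact drainfree_rigidity hs hcb hdb hintb hneb

/-! ## Half-line form (appended): the hypotheses of `DyadicScalarFronts` with the drain dropped

The construction item quantifies over solutions on `t < 0` that are integrable on `(−∞,0)`, BOUNDED NEAR `0⁻` and
non-zero somewhere on `t < 0` — no value or continuity at `0` is assumed.  For the drain-free equation the solution
is non-decreasing on `(−∞,0)`, so it has a finite left limit at `0`; extending by that limit reduces to
`drainfree_rigidity`. -/

/-- **Drain-free rigidity, half-line form.**  Let `s > 1` and let `b` solve `b'(t) = (4/s²) b(t/s)²` on `t < 0`, be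
integrable on `(−∞,0)`, bounded near `0⁻` and non-zero somewhere on `t < 0` (the admissibility clauses of
`WakeRatchetDyadicFront.DyadicScalarFronts`, drain dropped).  Then `s = 2`.
[cite: Tao2016AveragedNS, §1.2 (dyadic model); cell vocabulary (scalar front equation of `DyadicScalarFronts`, census item G0 of stmt-21808)] -/
theorem drainfree_rigidity_halfline (hs : 1 < s)
    (hd : ∀ t : ℝ, t < 0 → HasDerivAt b (4 / s ^ 2 * b (t / s) ^ 2) t)
    (hint : IntegrableOn b (Iio 0))
    (hbdd : ∃ t₀ : ℝ, t₀ < 0 ∧ ∃ P : ℝ, ∀ t : ℝ, t₀ ≤ t → t < 0 → |b t| ≤ P)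
    (hne : ∃ t : ℝ, t < 0 ∧ b t ≠ 0) : s = 2 := by
  -- monotonicity on the open half-line
  have hcIio : ContinuousOn b (Iio 0) := fun x hx => (hd x hx).continuousAt.continuousWithinAt
  have hmono : MonotoneOn b (Iio 0) := by
    refine monotoneOn_of_deriv_nonneg (convex_Iio 0) hcIio ?_ ?_
    · rw [interior_Iio]; intro x hx; exact (hd x hx).differentiableAt.differentiableWithinAt
    · rw [interior_Iio]; intro x hx
      rw [(hd x hx).deriv]
      positivity
  -- bounded above on `(−∞,0)`
  obtain ⟨t₀, ht₀, P, hP⟩ := hbdd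
  have hbddA : BddAbove (b '' Iio 0) := by
    refine ⟨P, ?_⟩
    rintro _ ⟨x, hx, rfl⟩
    rcases le_or_gt t₀ x with h | h
    · exact (le_abs_self _).trans (hP x h hx)
    · exact (hmono hx ht₀ h.le).trans ((le_abs_self _).trans (hP t₀ le_rfl ht₀))
  set L : ℝ := sSup (b '' Iio 0) with hL
  have hlim : Tendsto b (𝓝[<] (0 : ℝ)) (𝓝 L) := hmono.tendsto_nhdsLT hbddA
  -- the extension by the left limit
  set c : ℝ → ℝ := fun t => if t < 0 then b t else L with hc
  have hc_of_neg : ∀ t : ℝ, t < 0 → c t = b t := fun t ht => by simp [hc, ht]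
  have hc0 : c 0 = L := by simp [hc]
  have hdc : ∀ t : ℝ, t < 0 → HasDerivAt c (4 / s ^ 2 * c (t / s) ^ 2) t := by
    intro t ht
    have hs0 : 0 < s := by linarith
    have hts : t / s < 0 := div_neg_of_neg_of_pos ht hs0
    have hev : c =ᶠ[𝓝 t] b :=
      Filter.eventually_of_mem (Iio_mem_nhds ht) fun x hx => hc_of_neg x hx
    rw [hc_of_neg _ hts]
    exact (hd t ht).congr_of_eventuallyEq hev
  have hcc : ContinuousOn c (Iic 0) := by
    intro x hx
    rcases eq_or_lt_of_le (show x ≤ 0 from hx) with h | h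
    · rw [h]
      have h1 : ContinuousWithinAt c (Iio 0) 0 := by
        have h2 : Tendsto c (𝓝[<] (0 : ℝ)) (𝓝 L) :=
          hlim.congr' (eventually_nhdsWithin_of_forall fun x hx => (hc_of_neg x hx).symm)
        rw [ContinuousWithinAt, hc0]
        exact h2
      exact continuousWithinAt_Iio_iff_Iic.1 h1
    · exact (hdc x h).continuousAt.continuousWithinAt
  have hintc : IntegrableOn c (Iio 0) :=
    hint.congr_fun (fun x hx => (hc_of_neg x hx).symm) measurableSet_Iio
  obtain ⟨t₁, ht₁, hb₁⟩ := hne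
  have hnec : ∃ t : ℝ, t ≤ 0 ∧ c t ≠ 0 := ⟨t₁, ht₁.le, by rw [hc_of_neg t₁ ht₁]; exact hb₁⟩
  exact drainfree_rigidity hs hcc hdc hintc hnec

/-- **Drain-free rigidity, half-line form, `Λ`-normalisation.**  If `Λ > 0`, `s > 1` and `a` solves
`a'(t) = (Λ/s²) a(t/s)²` on `t < 0`, is integrable on `(−∞,0)`, bounded near `0⁻` and non-zero somewhere on
`t < 0` — verbatim the clauses of `WakeRatchetDyadicFront.DyadicScalarFronts` with the drain term `(s/Λ)a(t)a(st)`
dropped — then `s = 2`.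
[cite: Tao2016AveragedNS, §1.2 (dyadic model); cell vocabulary (scalar front equation of `DyadicScalarFronts`, census item G0 of stmt-21808)] -/
theorem drainfree_rigidity_bigLam_halfline {Λ : ℝ} {a : ℝ → ℝ} (hΛ : 0 < Λ) (hs : 1 < s)
    (hd : ∀ t : ℝ, t < 0 → HasDerivAt a (Λ / s ^ 2 * a (t / s) ^ 2) t)
    (hint : IntegrableOn a (Iio 0))
    (hbdd : ∃ t₀ : ℝ, t₀ < 0 ∧ ∃ P : ℝ, ∀ t : ℝ, t₀ ≤ t → t < 0 → |a t| ≤ P)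
    (hne : ∃ t : ℝ, t < 0 ∧ a t ≠ 0) : s = 2 := by
  set b : ℝ → ℝ := fun t => Λ / 4 * a t with hb
  have hdb : ∀ t : ℝ, t < 0 → HasDerivAt b (4 / s ^ 2 * b (t / s) ^ 2) t := by
    intro t ht
    refine ((hd t ht).const_mul (Λ / 4)).congr_deriv ?_
    show Λ / 4 * (Λ / s ^ 2 * a (t / s) ^ 2) = 4 / s ^ 2 * (Λ / 4 * a (t / s)) ^ 2
    ring
  have hintb : IntegrableOn b (Iio 0) := hint.const_mul (Λ / 4)
  obtain ⟨t₀, ht₀, P, hP⟩ := hbdd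
  have hbddb : ∃ t₀ : ℝ, t₀ < 0 ∧ ∃ P : ℝ, ∀ t : ℝ, t₀ ≤ t → t < 0 → |b t| ≤ P := by
    refine ⟨t₀, ht₀, Λ / 4 * P, fun t h1 h2 => ?_⟩
    show |Λ / 4 * a t| ≤ Λ / 4 * P
    rw [abs_mul, abs_of_pos (by positivity : (0 : ℝ) < Λ / 4)]
    exact mul_le_mul_of_nonneg_left (hP t h1 h2) (by positivity)
  obtain ⟨t₁, ht₁, hne₁⟩ := hne
  have hneb : ∃ t : ℝ, t < 0 ∧ b t ≠ 0 := ⟨t₁, ht₁, mul_ne_zero (by positivity) hne₁⟩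
  exact drainfree_rigidity_halfline hs hdb hintb hbddb hneb

end WakeRatchetRelayDrainFreeRigidity

end Summit.NavierStokesRegularity.NavierStokesRegularity.Theorems

end
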